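import Summits.BirchSwinnertonDyer.BirchSwinnertonDyer.Theorems.ErratumRoadFiveNonSurjCornerKolyJSwapNamedFacts
import Summits.BirchSwinnertonDyer.BirchSwinnertonDyer.Theorems.ErratumRoadFiveNonSurjCornerImageFull
import HarnessLib

/-!
# Route `ErratumRoadFive` (rung K2), crux child `NonSurjCornerKolyJ` (item stmt-BirchSwinnertonDyer-19947): the
# registered stub `stub_kolyJ_max` ⟸ THREE NAMED LITERATURE FACTS ONLY — the image hypothesis
# `−1 ∈ ρ̄_{E,7}(Γ_ℚ)` of lane A's display v6 (`…KolyJSwapNamedFacts`, `hneg7`) is a THEOREM on the corner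
# (courtesy file from lane B, cell `bsd-stepL`, seat `bsd-stepL-corner5-p2` g5; `--supports stmt-BirchSwinnertonDyer-19947 --as helper`)

WHY THIS FILE. Lane A's `nonSurjCornerKolyJ_max_of_namedFacts` (seat corner-p1 g11, p562995-series) proves the registered
signature of `stub_kolyJ_max` VERBATIM from three cite-only Literature facts `h37` (Gross 1991 Prop. 3.7 (2)), `hPT`
(Poitou–Tate for Selmer structures), `hF1` (Gross 1991 §6 ∕ [GZ86 III (3.1)] image-free) AND one more hypothesis
`hneg7 : ∀ W p, ClassX11b W p → ¬ Surj W p → p = 7 → ∃ γ, ∀ P ∈ E[p], γ • P = −P` («the genuine image restriction at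
`p = 7`: Cartan-normaliser images without `−I` exist at 7»). On the CORNER that restriction is VOID: lane B's
`CornerShape.NonSurjCorner.exists_smul_eq_neg_seven` (seat corner5-p2 g2, file `…NonSurjCornerImageFull`, p542478) shows that
for every pair with `ClassX11b W 7 ∧ ¬ Surj W 7` the image is the FULL normaliser of a split Cartan subgroup (the inertia
half-Cartan at the multiplicative prime `7` plus one element of `N ∖ C` force `C ≤ G`), which contains `−I`. Hence:

* `nonSurjCorner_hneg7_holds` — lane A's hypothesis `hneg7`, literally, is a theorem;
* **`nonSurjCornerKolyJ_max_of_threeNamedFacts (h37) (hPT) (hF1)`** — the registered signature of `stub_kolyJ_max`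
  VERBATIM from the THREE named Literature facts alone (lane A's theorem with `hneg7` discharged).

(At `p = 5` lane A already uses x11c's `GaloisImage.exists_smul_eq_neg_five_of_irr`; lane B's
`NonSurjCorner.exists_smul_eq_neg_five` of `…NonSurjCornerFiveImageExact` is the exact-image form of the same fact.)
HONEST FRAMING: a two-line composition of landed theorems; CONDITIONAL on the same three published, typed, unformalised facts;
the registered stub is NOT discharged; no item closes; nothing about any curve's BSD; T7. Credit: corner-p1 g8–g11 (the whole
chain), corner5-p2 g2 (`−1` at 7).
References (locators only): [cite: McCallumLMS1991, §4 Prop. 4.4, §5 Prop. 5.2] [cite: GrossLMS1991, Prop. 3.7 (2), §6]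
[cite: GrossZagier1986, III (3.1)] [cite: Serre1972, §2.2] [cite: Jetchev2008, Thm. 1.4].
-/

set_option linter.dupNamespace false -- `Summit.BirchSwinnertonDyer.BirchSwinnertonDyer` (summit = problem), tree-wide

noncomputable section

open scoped Classical Pointwise
open Function NumberField IsDedekindDomain WeierstrassCurve Field
open Literature.NumberTheory.EllipticCurves Literature.NumberTheory.GaloisRepresentations
open Literature.NumberTheory.EllipticCurves.Jetchev2008 Literature.NumberTheory.EllipticCurves.KolyvaginCocycle
open Literature.NumberTheory.EllipticCurves.ModularForms
open Literature.NumberTheory.GaloisCohomology Literature.NumberTheory.Automorphic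
open Literature.NumberTheory.GaloisRepresentations.DiscreteGaloisModule (transverseSubgroup SelmerStructure)
open Summit.BirchSwinnertonDyer.Rank1Residual.JET.SelmerVocabulary
open Summit.BirchSwinnertonDyer.Rank1Residual.JET.GlobalDuality
open Summit.BirchSwinnertonDyer.Rank1Residual.X11b
open Summit.BirchSwinnertonDyer.Rank1Residual.X11b.Three
open Summit.BirchSwinnertonDyer.BirchSwinnertonDyer.Theorems
open Summit.BirchSwinnertonDyer.BirchSwinnertonDyer.Theorems.HeegnerE0ImageFree
open Summit.BirchSwinnertonDyer.Rank1Residual.X11b.Three.Koly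
open Summit.BirchSwinnertonDyer.BirchSwinnertonDyer.Theorems.CornerShape
open Literature.NumberTheory.EllipticCurves.Rank1Residual

namespace Summit.BirchSwinnertonDyer.Rank1Residual.X11b.Three.Koly

/-- **Lane A's hypothesis `hneg7` is a theorem**: for every pair with `ClassX11b W 7 ∧ ¬ Surj W 7` some `γ ∈ Γ_ℚ` acts as
`−1` on `E[7]` (the corner's mod-`7` image is the full normaliser of a split Cartan subgroup, which contains `−I`:
`CornerShape.NonSurjCorner.exists_smul_eq_neg_seven`). Stated in the exact shape of the hypothesis (`p` with `p = 7`).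
[cite: Serre1972, §2.2 Prop. 14, §2.7 Prop. 17] -/
theorem nonSurjCorner_hneg7_holds :
    ∀ (W : WeierstrassCurve ℚ) [W.IsElliptic] [W.IsGloballyMinimal] [NeZero (W.conductorNorm ℤ)]
      (p : ℕ) [Fact p.Prime], ClassX11b W p → ¬ Surj W p → p = 7 →
      ∃ γ : Field.absoluteGaloisGroup ℚ, ∀ P : geomTorsion W p, γ • P = -P := by
  intro W _ _ _ p _ hX hns hp
  subst hp
  exact NonSurjCorner.exists_smul_eq_neg_seven W hX hns

/-- **`stub_kolyJ_max` (child 19947 of crux `NonSurjCorner`) from THREE NAMED LITERATURE FACTS ONLY** — Gross 1991 Prop. 3.7 (2)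
(`h37`), Poitou–Tate duality for Selmer structures (`hPT`), Gross 1991 §6 ∕ [GZ86 III (3.1)] image-free (`hF1`): lane A's
`nonSurjCornerKolyJ_max_of_namedFacts` with its fourth hypothesis `hneg7` discharged by `nonSurjCorner_hneg7_holds`. The
conclusion is the registered signature VERBATIM. CONDITIONAL (three cite-only facts); the stub is not discharged.
[cite: Jetchev2008, Thm. 1.4 (p. 812)] [cite: McCallumLMS1991, §4 Prop. 4.4, §5 Prop. 5.2] [cite: GrossLMS1991, Prop. 3.7 (2), §6 Prop. 6.2 (1)]
[cite: GrossZagier1986, III (3.1)] -/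
theorem nonSurjCornerKolyJ_max_of_threeNamedFacts
    (h37 : GrossLMS1991.prop37_2_frobeniusCongruence)
    (hPT : ∀ (K : Type) [Field K] [NumberField K], poitouTate_selmerStructure_duality_conj K)
    (hF1 : Gross1991_heegnerPoint_sub_ratTorsion_mem_E0_imageFree) :
    ∀ (W : WeierstrassCurve ℚ) [W.IsElliptic] [W.IsGloballyMinimal] [NeZero (W.conductorNorm ℤ)]
      (p : ℕ) [Fact p.Prime] (K : Type) [Field K] [NumberField K]
      (Dt : ModularParametrizationData W (W.conductorNorm ℤ)) (β : ℤ) (ι : K →+* ℂ),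
      p ∣ W.tamagawaProduct →
      ClassX11b W p → ¬ Surj W p → (p = 5 ∨ p = 7) → p ∣ padicValInt p W.minimalDiscriminantInt →
      ¬ Ram W p → IsImaginaryQuadratic K → 4 < (NumberField.discr K).natAbs →
      SatisfiesHeegnerHypothesis (W.conductorNorm ℤ) K → SatisfiesHeegnerHypothesis p K →
      (4 * (W.conductorNorm ℤ : ℤ)) ∣ β ^ 2 - NumberField.discr K → ¬ (p : ℤ) ∣ Dt.c →
      ∀ (v : HeightOneSpectrum (𝓞 ℚ)) (s : ℕ), s ≤ padicValNat p (W.tamagawaNumberAt v) →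
        ∀ (n : ℕ) (d : KolyvaginHeegnerData Dt β ι n), Squarefree n →
          (∀ ℓ ∈ n.primeFactors, Zhang2014.IsKolyvaginPrime (W.conductorNorm ℤ) W K p ℓ ∧
            s ≤ Zhang2014.kolyvaginIndex W p ℓ) → PDiv d p s :=
  nonSurjCornerKolyJ_max_of_namedFacts h37 hPT hF1 nonSurjCorner_hneg7_holds

end Summit.BirchSwinnertonDyer.Rank1Residual.X11b.Three.Koly

end
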